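import Mathlib.LinearAlgebra.Matrix.Rank
import Mathlib.LinearAlgebra.Matrix.Dual
import Mathlib.LinearAlgebra.Dual.Lemmas
import Mathlib.Data.ZMod.Basic
import Mathlib.Algebra.Field.ZMod
import Mathlib.Algebra.CharP.Two
import Mathlib.Tactic.LinearCombination
import Mathlib.Tactic.Ring
import HarnessLib

/-!
# Cell `bsd-monsky`: AOKI = MONSKY FOR EVERY NUMBER OF PRIME FACTORS — part 1, the bilinear forms
# (pure `𝔽₂`-linear algebra; nothing arithmetic asserted)

HONEST FRAMING (cell `bsd-monsky`, run/shared/lean/pub/bsd-monsky/, README §1: ONE theorem on ONE explicit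
infinite family of quadratic twists of the congruent number curve at the prime `2`; not "BSD for rank ≤ 1",
nothing at odd primes, nothing booked until the cross-family referee passes the written proof). This file
and its sequel `…EvenAokiMonskyKernel.lean` assert NO arithmetic fact: they are the linear algebra behind
the identity «Aoki 1999 Thm 2.2's closed formula for `dim_{𝔽₂} Sel₂(E_n)` EQUALS `2 + s(n)`, `s(n)` =
Monsky's even matrix count (appendix to Heath-Brown 1994)» for EVERY square-free `n = 2p₁⋯p_k ≡ 6 (mod 8)`
— the tree had it at `k = 2` only (`P2/CongruentNumberEvenPairAokiMonsky.lean`, sixteen symbol patterns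
by `decide`); here it is uniform in `k`, by hand.

## The dictionary (prover-B g11; `ι` = the index set of the odd primes `p₁, …, p_k`)

Over `𝔽₂` put `ε_i = [p_i ≡ 3 (4)]`, `t_i = [(2/p_i) = −1]`, `A` = Monsky's matrix (`A_ij = [(p_j/p_i) = −1]`,
zero row sums) and `L = Aᵀ + D_t`. Then
* Monsky's even matrix is `M = ( L  D_ε ; D_t  Lᵀ )` (`( Aᵀ + D₂  D₋₁ ; D₂  A + D₂ )`);
* quadratic reciprocity reads `Lᵀ = L + εεᵀ + D_ε` (`hLT`), the zero row sums of `A` read `Σ_j L_ji = t_i`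
  (`hcol`), and `n ≡ 6 (mod 8)` reads `Σ ε = 1` (`hodd`);
* Aoki's symbols are `λ_{p_j}(p_i) = L_ij`, `λ_{p_j}(2) = t_j`, `λ₂(p_i) = t_i`; `T = T₁ = {ε = 0}`,
  `S₂ = {ε = 1}`; the essential space `v(Sel₀^{(φ′)})` is `W = {u : (u ᵥ* L)_j = 0 ∀ j ∈ T₁}` and the Gram
  matrix of `( , )_V` is `G_il = Σ_j ε_j L_ij L_lj + δ_il t_i + (t_i ε_l + ε_i t_l)`.

## What is proved here

§1 three generalities over a field: the column space of `C` is the annihilator of its left kernel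
(`exists_mulVec_eq_of_forall_vecMul_eq_zero`, through `LinearMap.range_dualMap_eq_dualAnnihilator_ker`),
`dim {w : w ᵥ* C = 0} + rank C = #rows`, and the rank of a Gram-type matrix `(w ⬝ G w')` taken over ALL
elements of a subspace `W` is `dim W − dim {u ∈ W : w ⬝ G u = 0 ∀ w ∈ W}` (`rank_gram_add_finrank`; this is
Aoki's `rank ᵗΦ G Φ` read basis-free, as the tree types it). §2 the bookkeeping of
the shape: symmetry of `L` at `T₁`, the transpose formula, zero column sums, and THE KEY IDENTITY
`dotProduct_gram_mulVec_of_memW`: for `w, u ∈ W`, `w ⬝ (G u) = Σ_i t_i w_i u_i + (L w) ⬝ (L u)` — Aoki's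
Cassels pairing form coincides on `W` with the Schur-type form of Monsky's matrix. The kernel count and the
arithmetic instantiation are in the sequels. Companion note: HOME/proof/PROOF-B-AOKI-MONSKY.md.

References: [Aoki1999] Thm. 2.2 p. 81 and its proof p. 98; [HeathBrown1994SelmerCongruentII] Appendix
(Monsky), typescript p. 41 L20–L36; [IrelandRosen1990] Ch. 5 §2 (quadratic reciprocity).
-/

noncomputable section

open scoped Classical

open Matrix

set_option autoImplicit false

namespace Summit.BirchSwinnertonDyer.Rank1Residual.P2.AokiMonsky

/-! ## §1 Three generalities over a field -/

section Field

variable {K : Type*} [Field K] {ι κ : Type*} [Fintype ι] [Fintype κ]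

/-- **Column space = annihilator of the left kernel.** If `r` is orthogonal (for the dot product) to
every `w` with `w ᵥ* C = 0`, then `r = C *ᵥ y` for some `y`. [folklore] -/
theorem exists_mulVec_eq_of_forall_vecMul_eq_zero (C : Matrix ι κ K) (r : ι → K)
    (h : ∀ w : ι → K, w ᵥ* C = 0 → w ⬝ᵥ r = 0) : ∃ y : κ → K, C *ᵥ y = r := by
  set f : (ι → K) →ₗ[K] (κ → K) := Cᵀ.mulVecLin with hf
  have hmem : dotProductEquiv K ι r ∈ (LinearMap.ker f).dualAnnihilator := by
    rw [Submodule.mem_dualAnnihilator]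
    intro w hw
    rw [LinearMap.mem_ker, hf, Matrix.mulVecLin_apply, Matrix.mulVec_transpose] at hw
    simp only [dotProductEquiv_apply_apply]
    rw [dotProduct_comm]
    exact h w hw
  rw [← LinearMap.range_dualMap_eq_dualAnnihilator_ker] at hmem
  obtain ⟨ψ, hψ⟩ := hmem
  set y : κ → K := (dotProductEquiv K κ).symm ψ with hy
  have hψ' : ψ = dotProductEquiv K κ y := ((dotProductEquiv K κ).apply_symm_apply ψ).symm
  refine ⟨y, dotProduct_eq _ _ fun w => ?_⟩
  have key : ψ (f w) = r ⬝ᵥ w := by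
    have := LinearMap.congr_fun hψ w
    simpa only [LinearMap.dualMap_apply, dotProductEquiv_apply_apply] using this
  rw [hψ', dotProductEquiv_apply_apply, hf, Matrix.mulVecLin_apply, Matrix.mulVec_transpose,
    dotProduct_comm, ← Matrix.dotProduct_mulVec, dotProduct_comm] at key
  exact key

/-- **Dimension of a left kernel:** `dim {w : w ᵥ* C = 0} + rank C = #rows`. [folklore] -/
theorem finrank_ker_transpose_add_rank (C : Matrix ι κ K) :
    Module.finrank K (LinearMap.ker Cᵀ.mulVecLin) + C.rank = Fintype.card ι := by
  have h := LinearMap.finrank_range_add_finrank_ker Cᵀ.mulVecLin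
  rw [Module.finrank_pi K] at h
  have hr : Module.finrank K (LinearMap.range Cᵀ.mulVecLin) = C.rank := by
    rw [← Matrix.rank_transpose C]; rfl
  omega

/-- **Rank of a Gram-type matrix over all elements of a subspace.** Let `W` be a subspace of
`K^ι` enumerated by the finite set `Wfin` (all its elements) and `G` any square matrix; the matrix
`(w ⬝ᵥ G *ᵥ w')_{w, w' ∈ Wfin}` has rank `dim W − dim {u ∈ W : w ⬝ᵥ G *ᵥ u = 0 ∀ w ∈ W}`. [folklore] -/
theorem rank_gram_add_finrank (G : Matrix ι ι K) (Wfin : Finset (ι → K))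
    (W : Submodule K (ι → K)) (hW : ∀ u, u ∈ Wfin ↔ u ∈ W) :
    (Matrix.of fun w w' : ↥Wfin => (w : ι → K) ⬝ᵥ (G *ᵥ (w' : ι → K))).rank +
      Module.finrank K ↥(W ⊓ LinearMap.ker
        (Matrix.of fun (w : ↥Wfin) (i : ι) => ((w : ι → K) ᵥ* G) i).mulVecLin) =
      Module.finrank K W := by
  set B : Matrix (↥Wfin) ι K := Matrix.of fun (w : ↥Wfin) (i : ι) => ((w : ι → K) ᵥ* G) i with hB
  set E : Matrix ι (↥Wfin) K := Matrix.of fun (i : ι) (w : ↥Wfin) => (w : ι → K) i with hE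
  have hgram : (Matrix.of fun w w' : ↥Wfin => (w : ι → K) ⬝ᵥ (G *ᵥ (w' : ι → K))) = B * E := by
    ext w w'
    rw [Matrix.mul_apply, Matrix.of_apply, Matrix.dotProduct_mulVec]
    rfl
  -- the range of `E` is the span of the vectors of `Wfin`, i.e. `W`
  have hE_range : LinearMap.range E.mulVecLin = W := by
    apply le_antisymm
    · rintro _ ⟨c, rfl⟩
      rw [Matrix.mulVecLin_apply]
      have : E *ᵥ c = ∑ w : ↥Wfin, c w • ((w : ι → K)) := by
        ext i
        simp only [Matrix.mulVec, dotProduct, hE, Matrix.of_apply, Finset.sum_apply, Pi.smul_apply,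
          smul_eq_mul]
        exact Finset.sum_congr rfl fun w _ => mul_comm _ _
      rw [this]
      exact W.sum_mem fun w _ => W.smul_mem _ ((hW _).mp w.2)
    · intro u hu
      refine ⟨Pi.single (⟨u, (hW u).mpr hu⟩ : ↥Wfin) 1, ?_⟩
      rw [Matrix.mulVecLin_apply]
      ext i
      rw [Matrix.mulVec_single_one]
      rfl
  have hrank : (B * E).rank = Module.finrank K (W.map B.mulVecLin) := by
    rw [Matrix.rank, Matrix.mulVecLin_mul, LinearMap.range_comp, hE_range]
  -- rank–nullity for `B` restricted to `W`
  have hrn := LinearMap.finrank_range_add_finrank_ker (B.mulVecLin ∘ₗ W.subtype)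
  rw [LinearMap.range_comp, Submodule.range_subtype, LinearMap.ker_comp] at hrn
  have hker : Module.finrank K ↥(Submodule.comap W.subtype (LinearMap.ker B.mulVecLin)) =
      Module.finrank K ↥(W ⊓ LinearMap.ker B.mulVecLin) := by
    have heq : Submodule.comap W.subtype (LinearMap.ker B.mulVecLin) =
        Submodule.comap W.subtype (W ⊓ LinearMap.ker B.mulVecLin) := by
      rw [Submodule.comap_inf, Submodule.comap_subtype_self, top_inf_eq]
    rw [heq]
    exact (Submodule.comapSubtypeEquivOfLe inf_le_left).finrank_eq
  rw [hgram, hrank, ← hrn, hker]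

end Field

/-! ## §2 Monsky's even matrix in the shape `M = ( L  D_ε ; D_t  Lᵀ )`, `L = Aᵀ + D_t`:
quadratic reciprocity `Lᵀ = L + εεᵀ + D_ε`, zero row sums `Σ_j L_ji = t_i`, `Σ ε = 1` -/

section Shape

variable {ι : Type*} [Fintype ι] [DecidableEq ι] (L : Matrix ι ι (ZMod 2)) (ε t : ι → ZMod 2)

omit [Fintype ι] in
/-- `L` is symmetric at the indices `j` with `ε_j = 0` (the primes `≡ 1 (mod 4)`). [folklore] -/
theorem apply_symm_of_eps_eq_zero
    (hLT : ∀ i j, L j i = L i j + ε i * ε j + if i = j then ε i else 0) {i j : ι} (hj : ε j = 0) :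
    L j i = L i j := by
  by_cases hij : i = j
  · subst hij; rfl
  · have h := hLT i j
    rw [if_neg hij, hj, mul_zero, add_zero, add_zero] at h
    exact h

/-- At an index with `ε_j = 0`, `(u ᵥ* L)_j = (L *ᵥ u)_j`. [folklore] -/
theorem vecMul_apply_eq_mulVec_apply
    (hLT : ∀ i j, L j i = L i j + ε i * ε j + if i = j then ε i else 0) (u : ι → ZMod 2) {j : ι}
    (hj : ε j = 0) : (u ᵥ* L) j = (L *ᵥ u) j := by
  simp only [Matrix.vecMul, Matrix.mulVec, dotProduct]
  exact Finset.sum_congr rfl fun i _ => by rw [apply_symm_of_eps_eq_zero L ε hLT hj, mul_comm]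

/-- The transpose formula `(u ᵥ* L)_j = (L *ᵥ u)_j + ε_j (ε ⬝ u) + ε_j u_j` (`Lᵀ = L + εεᵀ + D_ε`). [folklore] -/
theorem vecMul_apply_eq
    (hLT : ∀ i j, L j i = L i j + ε i * ε j + if i = j then ε i else 0) (u : ι → ZMod 2) (j : ι) :
    (u ᵥ* L) j = (L *ᵥ u) j + ε j * (∑ i, ε i * u i) + ε j * u j := by
  simp only [Matrix.vecMul, Matrix.mulVec, dotProduct]
  have h : ∀ i, u i * L i j = L j i * u i + ε j * (ε i * u i) + (if j = i then ε j * u i else 0) := by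
    intro i
    rw [hLT j i]
    split_ifs <;> ring
  rw [Finset.sum_congr rfl fun i _ => h i, Finset.sum_add_distrib, Finset.sum_add_distrib,
    ← Finset.mul_sum, Finset.sum_ite_eq, if_pos (Finset.mem_univ j)]

omit [DecidableEq ι] in
/-- Zero row sums of `A`: `Σ_j (L *ᵥ u)_j = Σ_i t_i u_i`. [folklore] -/
theorem sum_mulVec_apply (hcol : ∀ i, ∑ j, L j i = t i) (u : ι → ZMod 2) :
    ∑ j, (L *ᵥ u) j = ∑ i, t i * u i := by
  simp only [Matrix.mulVec, dotProduct]
  rw [Finset.sum_comm]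
  exact Finset.sum_congr rfl fun i _ => by rw [← Finset.sum_mul, hcol i]

/-- For `u` in Aoki's essential space `W = {u : (u ᵥ* L)_j = 0 for ε_j = 0}`: `(L *ᵥ u)_j = 0` at
every `j` with `ε_j = 0`. [folklore] -/
theorem mulVec_apply_eq_zero_of_memW
    (hLT : ∀ i j, L j i = L i j + ε i * ε j + if i = j then ε i else 0) {u : ι → ZMod 2}
    (hu : ∀ j, ε j = 0 → (u ᵥ* L) j = 0) {j : ι} (hj : ε j = 0) : (L *ᵥ u) j = 0 := by
  rw [← vecMul_apply_eq_mulVec_apply L ε hLT u hj, hu j hj]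

/-- For `u ∈ W`: `ε_j (L *ᵥ u)_j = (L *ᵥ u)_j` for every `j`. [folklore] -/
theorem eps_mul_mulVec_apply_of_memW
    (hLT : ∀ i j, L j i = L i j + ε i * ε j + if i = j then ε i else 0) {u : ι → ZMod 2}
    (hu : ∀ j, ε j = 0 → (u ᵥ* L) j = 0) (j : ι) : ε j * (L *ᵥ u) j = (L *ᵥ u) j := by
  have h01 : ∀ x : ZMod 2, x = 0 ∨ x = 1 := by decide
  rcases h01 (ε j) with h | h
  · rw [h, zero_mul, mulVec_apply_eq_zero_of_memW L ε hLT hu h]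
  · rw [h, one_mul]

omit [DecidableEq ι] in
/-- For `u ∈ W`: `ε_j (u ᵥ* L)_j = (u ᵥ* L)_j` for every `j`. [folklore] -/
theorem eps_mul_vecMul_apply_of_memW {u : ι → ZMod 2} (hu : ∀ j, ε j = 0 → (u ᵥ* L) j = 0)
    (j : ι) : ε j * (u ᵥ* L) j = (u ᵥ* L) j := by
  have h01 : ∀ x : ZMod 2, x = 0 ∨ x = 1 := by decide
  rcases h01 (ε j) with h | h
  · rw [h, zero_mul, hu j h]
  · rw [h, one_mul]

/-- Extension by zero from `T₁ = {ε = 0}` followed by `Lᵀ` is the column block `C = L|_{ι × T₁}`: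
`(Lᵀ *ᵥ ext y)_i = (C *ᵥ y)_i` (symmetry of `L` at `T₁`). [folklore] -/
theorem transpose_mulVec_extend
    (hLT : ∀ i j, L j i = L i j + ε i * ε j + if i = j then ε i else 0)
    (y : {j // ε j = 0} → ZMod 2) (i : ι) :
    (Lᵀ *ᵥ fun j => if h : ε j = 0 then y ⟨j, h⟩ else 0) i =
      (L.submatrix id (Subtype.val : {j // ε j = 0} → ι) *ᵥ y) i := by
  simp only [Matrix.mulVec, dotProduct, Matrix.transpose_apply, Matrix.submatrix_apply, id]
  rw [← Fintype.sum_subtype_add_sum_subtype (fun j => ε j = 0)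
    (fun j => L j i * if h : ε j = 0 then y ⟨j, h⟩ else 0)]
  have h0 : ∑ j : {j // ¬ ε j = 0}, (L j i * if h : ε (j : ι) = 0 then y ⟨j, h⟩ else 0) = 0 :=
    Finset.sum_eq_zero fun j _ => by rw [dif_neg j.2, mul_zero]
  rw [h0, add_zero]
  exact Finset.sum_congr rfl fun j _ => by
    rw [dif_pos j.2, apply_symm_of_eps_eq_zero L ε hLT j.2]

/-- **Aoki's Gram form equals Monsky's Schur-type form on the essential space.** For `w, u ∈ W`:
`w ⬝ (G u) = Σ_i t_i w_i u_i + (L w) ⬝ (L u)`, where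
`G_il = Σ_j ε_j L_ij L_lj + δ_il t_i + (t_i ε_l + ε_i t_l)` is Aoki's Gram matrix of `( , )_V`
(`ᵗΛΛ + Δ + νΩ`). Uses `Lᵀ = L + εεᵀ + D_ε`, `Σ_j L_ji = t_i`, `Σ ε = 1`. [folklore] -/
theorem dotProduct_gram_mulVec_of_memW
    (hLT : ∀ i j, L j i = L i j + ε i * ε j + if i = j then ε i else 0)
    (hcol : ∀ i, ∑ j, L j i = t i) (hodd : ∑ j, ε j = 1)
    (G : Matrix ι ι (ZMod 2))
    (hG : ∀ i l, G i l = (∑ j, ε j * (L i j * L l j)) + (if i = l then t i else 0) +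
      (t i * ε l + ε i * t l))
    {w u : ι → ZMod 2} (hw : ∀ j, ε j = 0 → (w ᵥ* L) j = 0) (hu : ∀ j, ε j = 0 → (u ᵥ* L) j = 0) :
    w ⬝ᵥ (G *ᵥ u) = (∑ i, t i * (w i * u i)) + (L *ᵥ w) ⬝ᵥ (L *ᵥ u) := by
  -- abbreviations (opaque atoms with defining equations)
  obtain ⟨a, ha⟩ : ∃ a : ι → ZMod 2, a = L *ᵥ w := ⟨_, rfl⟩
  obtain ⟨b, hb⟩ : ∃ b : ι → ZMod 2, b = L *ᵥ u := ⟨_, rfl⟩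
  obtain ⟨A, hA⟩ : ∃ A : ι → ZMod 2, A = w ᵥ* L := ⟨_, rfl⟩
  obtain ⟨B, hB⟩ : ∃ B : ι → ZMod 2, B = u ᵥ* L := ⟨_, rfl⟩
  obtain ⟨cw, hcw⟩ : ∃ c : ZMod 2, c = ∑ i, ε i * w i := ⟨_, rfl⟩
  obtain ⟨cu, hcu⟩ : ∃ c : ZMod 2, c = ∑ i, ε i * u i := ⟨_, rfl⟩
  obtain ⟨τw, hτw⟩ : ∃ c : ZMod 2, c = ∑ i, t i * w i := ⟨_, rfl⟩
  obtain ⟨τu, hτu⟩ : ∃ c : ZMod 2, c = ∑ i, t i * u i := ⟨_, rfl⟩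
  -- pointwise facts
  have hAj : ∀ j, A j = a j + ε j * cw + ε j * w j := fun j => by
    rw [hA, ha, hcw]; exact vecMul_apply_eq L ε hLT w j
  have hBj : ∀ j, B j = b j + ε j * cu + ε j * u j := fun j => by
    rw [hB, hb, hcu]; exact vecMul_apply_eq L ε hLT u j
  have hea : ∀ j, ε j * a j = a j := fun j => by
    rw [ha]; exact eps_mul_mulVec_apply_of_memW L ε hLT hw j
  have heb : ∀ j, ε j * b j = b j := fun j => by
    rw [hb]; exact eps_mul_mulVec_apply_of_memW L ε hLT hu j
  have heA : ∀ j, ε j * A j = A j := fun j => by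
    rw [hA]; exact eps_mul_vecMul_apply_of_memW L ε hw j
  have hsa : ∑ j, a j = τw := by rw [ha, hτw]; exact sum_mulVec_apply L t hcol w
  have hsb : ∑ j, b j = τu := by rw [hb, hτu]; exact sum_mulVec_apply L t hcol u
  have hsq : ∀ x : ZMod 2, x * x = x := by decide
  have hε2 : ∀ j, ε j * ε j = ε j := fun j => hsq (ε j)
  have h20 : (2 : ZMod 2) = 0 := by decide
  -- step 1: expand `w ⬝ (G u)`
  have hpt : ∀ i l, w i * (G i l * u l) = (w i * u l) * (∑ j, ε j * (L i j * L l j)) +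
      (if i = l then t i * (w i * u l) else 0) +
      (t i * w i * (ε l * u l) + ε i * w i * (t l * u l)) := by
    intro i l; rw [hG i l]; split_ifs <;> ring
  have hSA : ∑ i, ∑ l, (w i * u l) * (∑ j, ε j * (L i j * L l j)) = ∑ j, ε j * (A j * B j) := by
    have hA' : ∀ j, A j = ∑ i, w i * L i j := fun j => by rw [hA]; rfl
    have hB' : ∀ j, B j = ∑ l, u l * L l j := fun j => by rw [hB]; rfl
    have eL : ∀ i l, (w i * u l) * (∑ j, ε j * (L i j * L l j)) =
        ∑ j, (w i * u l) * (ε j * (L i j * L l j)) := fun i l => Finset.mul_sum _ _ _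
    have eR : ∀ j, ε j * (A j * B j) = ∑ i, ∑ l, ε j * ((w i * L i j) * (u l * L l j)) := by
      intro j
      rw [hA', hB', Finset.sum_mul_sum, Finset.mul_sum]
      exact Finset.sum_congr rfl fun i _ => Finset.mul_sum _ _ _
    rw [Finset.sum_congr rfl fun j _ => eR j]
    conv_rhs => rw [Finset.sum_comm]
    refine Finset.sum_congr rfl fun i _ => ?_
    rw [Finset.sum_congr rfl fun l _ => eL i l]
    conv_lhs => rw [Finset.sum_comm]
    exact Finset.sum_congr rfl fun j _ => Finset.sum_congr rfl fun l _ => by ring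
  have hSB : ∑ i, ∑ l, (if i = l then t i * (w i * u l) else 0) = ∑ i, t i * (w i * u i) :=
    Finset.sum_congr rfl fun i _ => by rw [Finset.sum_ite_eq, if_pos (Finset.mem_univ i)]
  have hSC : ∑ i, ∑ l, (t i * w i * (ε l * u l) + ε i * w i * (t l * u l)) = τw * cu + cw * τu := by
    rw [hτw, hcu, hcw, hτu, Finset.sum_mul_sum, Finset.sum_mul_sum, ← Finset.sum_add_distrib]
    exact Finset.sum_congr rfl fun i _ => by rw [← Finset.sum_add_distrib]
  have h1 : w ⬝ᵥ (G *ᵥ u) =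
      (∑ j, ε j * (A j * B j)) + (∑ i, t i * (w i * u i)) + (τw * cu + cw * τu) := by
    have hL : w ⬝ᵥ (G *ᵥ u) = ∑ i, ∑ l, w i * (G i l * u l) := by
      simp only [dotProduct, Matrix.mulVec, Finset.mul_sum]
    rw [hL, ← hSA, ← hSB, ← hSC, ← Finset.sum_add_distrib, ← Finset.sum_add_distrib]
    refine Finset.sum_congr rfl fun i _ => ?_
    rw [← Finset.sum_add_distrib, ← Finset.sum_add_distrib]
    exact Finset.sum_congr rfl fun l _ => hpt i l
  -- step 2: `Σ_j ε_j A_j B_j` expanded through the transpose formula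
  have h2 : ∑ j, ε j * (A j * B j) =
      (∑ j, a j * b j) + τw * cu + cw * τu + cw * cu +
        ((∑ j, a j * u j) + (∑ j, w j * b j) + ∑ j, ε j * (w j * u j)) := by
    have hpt2 : ∀ j, ε j * (A j * B j) = a j * b j + a j * cu + a j * u j + b j * cw +
        ε j * (cw * cu) + ε j * u j * cw + w j * b j + ε j * w j * cu + ε j * (w j * u j) := by
      intro j
      rw [← mul_assoc, heA j, hAj j, hBj j]
      linear_combination (cu + u j) * hea j + (cw + w j) * heb j +
        (cw * cu + cw * u j + w j * cu + w j * u j) * hε2 j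
    rw [Finset.sum_congr rfl fun j _ => hpt2 j]
    simp only [Finset.sum_add_distrib, ← Finset.sum_mul]
    rw [hsa, hsb, hodd, ← hcu, ← hcw]
    linear_combination (cw * cu) * h20
  -- step 3: `Σ_j a_j u_j = u ⬝ (L w) = (u ᵥ* L) ⬝ w`
  have h3 : ∑ j, a j * u j = (∑ j, w j * b j) + cu * cw + ∑ j, ε j * (w j * u j) := by
    have h := Matrix.dotProduct_mulVec u L w
    rw [← ha, ← hB] at h
    simp only [dotProduct] at h
    calc ∑ j, a j * u j = ∑ j, u j * a j := Finset.sum_congr rfl fun j _ => mul_comm _ _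
      _ = ∑ j, B j * w j := h
      _ = ∑ j, (w j * b j + (ε j * w j) * cu + ε j * (w j * u j)) :=
          Finset.sum_congr rfl fun j _ => by rw [hBj j]; ring
      _ = (∑ j, w j * b j) + cu * cw + ∑ j, ε j * (w j * u j) := by
          rw [Finset.sum_add_distrib, Finset.sum_add_distrib, ← Finset.sum_mul, ← hcw]; ring
  -- assemble
  rw [h1, h2, h3, ← ha, ← hb]
  simp only [dotProduct]
  linear_combination (τw * cu + cw * τu + cw * cu + (∑ j, w j * b j) +
    ∑ j, ε j * (w j * u j)) * h20

end Shape

end Summit.BirchSwinnertonDyer.Rank1Residual.P2.AokiMonsky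

end
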